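import Summits.BirchSwinnertonDyer.Rank1Residual.Supersingular.KuriharaTwistSymbolSystem
import Summits.BirchSwinnertonDyer.Rank1Residual.Supersingular.KuriharaTwistIdentityBins
import Summits.BirchSwinnertonDyer.BirchSwinnertonDyer.Theorems.SelmerRankSelmerRankLBStubDeltaParityLemmas
import Mathlib.Data.ZMod.QuotientRing
import Mathlib.Algebra.Group.Pi.Units
import HarnessLib

/-!
# The plus symbol in CRT coordinates II: the `ℤ/p^k`-valued DISTRIBUTION SYSTEM of a Hecke-compatible
# `P : ℚ → ℚ`, the bins-to-`δ̃` identity at the full level, and its Chinese-remainder transport to `(ℤ/n)ˣ`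
# (KERNEL; the "sibling file" left open in `KuriharaTwistIdentityBins.lean`, abstract in `P`)

Cell `b2b-bsdres`, supersingular family, prover A = unit `b2b-bsdres-x10b` (gen 10).  Topic file; namespace
`Summit.BirchSwinnertonDyer.Rank1Residual.Supersingular.KuriharaTwist.Identity`.  TOOL THEOREMS of
elementary algebra (two `noncomputable def`s: the distribution system and the CRT equivalence; one integer
numerator `crtInt`); no named fact, no elliptic curve, nothing booked; marks unchanged.

HONEST FRAMING (run/shared/lean/b2b/bsd-rank1-residual/, verbatim in every file): the goal of the
cell is to DELETE the COMBINATION-SHAPED residual classes of the Birch–Swinnerton-Dyer formula for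
ALL analytic-rank `≤ 1` elliptic curves over `ℚ` — "full BSD formula for every rank `≤ 1` curve in
class `C`" assembled STRICTLY from published theorems — so that the rank-`≤ 1` remainder becomes
exactly the CONSTRUCTION-SHAPED classes, which are TYPED (missing-input `Prop`s), NOT attempted.
This is not "finishing BSD".

## What this file proves

For distinct primes `ℓ_i` (`i ∈ ι`, finite), a `1`-periodic `P : ℚ → ℚ` with the Hecke relation
`A_i·P(r) = Σ_{j mod ℓ_i} P((r+j)/ℓ_i) + P(ℓ_i r)` and `A_i ≡ 2 (mod p^k)` at every `ℓ_i`, `p`-integral at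
all level arguments (for the plus symbol `[·]⁺_f` of the newform of `E`: `ratPlusSymbol_add_intCast_eq`,
`intCast_mul_ratPlusSymbol`, Kolyvagin primes `ℓ_i ≡ 1`, `a_{ℓ_i} ≡ ℓ_i + 1`, and `p`-integrality from
`E[p]` irreducible — the instantiation is the next sibling):

* `symbolDist` — `P` IS a distribution system with eigenvalue `2` in n1011-p09's sense (`DistSystem ι
  (fun i => (ℤ/ℓ_i)ˣ) (ℤ/p^k)`: `x_U(a) = \overline{P(levelArg U a)}`, `g_i = frobElt i`; `dist` is the norm
  relation `sum_units_levelArg_update` of `KuriharaTwistSymbolSystem.lean` reduced modulo `p^k` by the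
  additivity of `\overline{·} = ratModP (p^k)` on `p`-integral rationals, `deltaParity_ratModP_*`).
* `sum_ratModP_levelArg_mul_choose_eq` — hence n1011-p09's `sum_mul_choose_val_eq` applies: at the full
  level, with `ν = #ι < p` and discrete logarithms `ψ_i : (ℤ/ℓ_i)ˣ → ℤ/p^k`, the binomial moments
  `Σ_a \overline{P}(a)·binom(m(a), t)` (`m(a) = (Σ_i ψ_i(a_i)).val`) VANISH for `t < ν` and equal the
  Kurihara sum `Σ_a \overline{P}(a)·Π_i ψ_i(a_i)` for `t = ν`.
* `unitsEquivPi` (`(ℤ/n)ˣ ≃* Π_i (ℤ/ℓ_i)ˣ`, `n = Π ℓ_i`, Mathlib's `ZMod.prodEquivPi` on units;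
  `unitsEquivPi_apply`: coordinate `i` is `ZMod.unitsMap (ℓ_i ∣ n)`, the map inside the tree's
  `kuriharaNumber`), `crtInt`, `levelArg_eq_crtInt_div`, `intCast_crtInt` (`crtInt ≡ a_j (mod ℓ_j)`),
  `apply_levelArg_unitsEquivPi` (`P(levelArg (e a)) = P(a.val/n)`: the CRT representative and the canonical
  representative differ by an integer) and
* `sum_units_ratModP_mul_choose_eq` — THE IDENTITY IN `(ℤ/n)ˣ` COORDINATES:
  `Σ_{a ∈ (ℤ/n)ˣ} \overline{P(a/n)}·binom((Σ_i ψ_i(a mod ℓ_i)).val, t) = [t = ν]·Σ_a \overline{P(a/n)}·Π_i ψ_i(a mod ℓ_i)`,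
  i.e. exactly the statement the twist-record recheck (`TwistRecord.consistent`: structure congruences
  `e_t ≡ 0`, `t < ν`, and `e_ν ≡ D·c_∞·δ̃_n`) relies on, for the sums defining the tree's `kuriharaNumber`.

References: n1011-p09's `KuriharaTwistIdentity{Prelim,,Bins}.lean` (the abstract leading-term lemma);
`KuriharaTwistSymbolSystem.lean` (the norm relation in CRT coordinates); B. Mazur, J. Tate, Duke Math. J. 54
(1987) §1.3 [MazurTate1987]; C.-H. Kim, arXiv:2203.12159 §1.4 [Kim2022StructureSelmer];
HOME/b2b-bsdres-x10b/X6-KURIHARA.md §10.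
-/

open Finset

/-! ## Part II — the `ℤ/p^k`-valued distribution system of `P`, the identity at the full level, and
the Chinese-remainder transport to `(ℤ/n)ˣ` -/

namespace Summit.BirchSwinnertonDyer.Rank1Residual.Supersingular.KuriharaTwist.Identity

open Literature.NumberTheory.DiophantineGeometry.Dioph (ratModP)
open Summit.BirchSwinnertonDyer.BirchSwinnertonDyer.Theorems (deltaParity_ratModP_sum
  deltaParity_ratModP_mul_sub_sub)

section Dist

variable {ι : Type*} [Fintype ι] [DecidableEq ι] (ℓ : ι → ℕ) [hℓ : ∀ i, Fact (ℓ i).Prime]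
  (hinj : Function.Injective ℓ) (P : ℚ → ℚ) (hper : ∀ (r : ℚ) (z : ℤ), P (r + z) = P r)
  {p : ℕ} [hp : Fact p.Prime] (k : ℕ) (A : ι → ℤ)
  (hhecke : ∀ (i : ι) (r : ℚ), (A i : ℚ) * P r =
    ∑ j : Fin (ℓ i), P ((r + ((j : ℕ) : ℚ)) / (ℓ i : ℚ)) + P ((ℓ i : ℚ) * r))
  (hA : ∀ i, ((A i : ℤ) : ZMod (p ^ k)) = 2)
  (hint : ∀ (U : Finset ι) (a : Π i, (ZMod (ℓ i))ˣ), ‖((P (levelArg ℓ U a) : ℚ) : ℚ_[p])‖ ≤ 1)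

/-- **THE DISTRIBUTION SYSTEM OF `P`** (n1011-p09's `DistSystem`, eigenvalue `2`, valued in `ℤ/p^k`):
`x_U(a) = \overline{P(levelArg U a)}`, `g_i = frobElt i = (ℓ_i mod ℓ_j)_j`; `inv` because `levelArg U`
reads only the `U`-coordinates; `dist` = the norm relation `sum_units_levelArg_update` reduced modulo
`p^k` (`\overline{·}` is additive on `p`-integral rationals, `deltaParity_ratModP_sum` /
`deltaParity_ratModP_mul_sub_sub`) with `A_i ≡ 2 (mod p^k)`.  Hypotheses: `P` `1`-periodic with the Hecke
relation at each `ℓ_i` (eigenvalue `A_i ≡ 2`), and `p`-integral at every level argument. [folklore] -/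
noncomputable def symbolDist : DistSystem ι (fun i => (ZMod (ℓ i))ˣ) (ZMod (p ^ k)) where
  x U a := ratModP (p ^ k) (P (levelArg ℓ U a))
  g := frobElt ℓ hinj
  inv U a b h := by
    show ratModP (p ^ k) (P (levelArg ℓ U a)) = ratModP (p ^ k) (P (levelArg ℓ U b))
    rw [levelArg_congr ℓ U h]
  dist U i hi c _ := by
    show ∑ b : (ZMod (ℓ i))ˣ, ratModP (p ^ k) (P (levelArg ℓ U (Function.update c i b))) =
      2 * ratModP (p ^ k) (P (levelArg ℓ (U.erase i) c)) -
        ratModP (p ^ k) (P (levelArg ℓ (U.erase i) (frobElt ℓ hinj i * c))) -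
        ratModP (p ^ k) (P (levelArg ℓ (U.erase i) ((frobElt ℓ hinj i)⁻¹ * c)))
    rw [← deltaParity_ratModP_sum k Finset.univ (fun b _ => hint U (Function.update c i b)),
      sum_units_levelArg_update ℓ hinj P hper hi (hhecke i) c,
      deltaParity_ratModP_mul_sub_sub k (A i) (hint _ c) (hint _ _) (hint _ _), hA i]

/-- The level functions of `symbolDist`, unfolded. [folklore] -/
theorem symbolDist_x (U : Finset ι) (a : Π i, (ZMod (ℓ i))ˣ) :
    (symbolDist ℓ hinj P hper k A hhecke hA hint).x U a = ratModP (p ^ k) (P (levelArg ℓ U a)) := rfl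

/-- At the full level the slice is everything. [folklore] -/
theorem slice_univ :
    slice (G := fun i => (ZMod (ℓ i))ˣ) (Finset.univ : Finset ι) = Finset.univ := by
  ext a
  simp [mem_slice]

include hinj hper hhecke hA hint in
/-- **THE BINS-TO-`δ̃` IDENTITY FOR `P` AT THE FULL LEVEL** (n1011-p09's `sum_mul_choose_val_eq` for
`symbolDist`): with `ν = #ι < p`, discrete logarithms `ψ_i : (ℤ/ℓ_i)ˣ → ℤ/p^k` and the bin index
`m(a) = (Σ_i ψ_i(a_i)).val`, for `t ≤ ν`:
`Σ_a \overline{P(levelArg a)}·binom(m(a), t) = [t = ν]·Σ_a \overline{P(levelArg a)}·Π_i ψ_i(a_i)`.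
[cite: Kim2022StructureSelmer, §1.4.3 (PDF p. 7)] -/
theorem sum_ratModP_levelArg_mul_choose_eq (ψ : Π i, (ZMod (ℓ i))ˣ →* Multiplicative (ZMod (p ^ k)))
    (hcard : Fintype.card ι < p) (t : ℕ) (ht : t ≤ Fintype.card ι) :
    ∑ a : Π i, (ZMod (ℓ i))ˣ, ratModP (p ^ k) (P (levelArg ℓ Finset.univ a)) *
        ((((∑ i, Multiplicative.toAdd (ψ i (a i))).val.choose t : ℕ) : ZMod (p ^ k))) =
      if t = Fintype.card ι then
        ∑ a : Π i, (ZMod (ℓ i))ˣ, ratModP (p ^ k) (P (levelArg ℓ Finset.univ a)) *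
          ∏ i, Multiplicative.toAdd (ψ i (a i))
      else 0 := by
  have h := sum_mul_choose_val_eq hp.out (symbolDist ℓ hinj P hper k A hhecke hA hint) ψ Finset.univ
    (by rw [Finset.card_univ]; exact hcard) t (by rw [Finset.card_univ]; exact ht)
  simp only [symbolDist_x, slice_univ, Finset.card_univ] at h
  exact h

end Dist

/-! ### Chinese remainder: `(ℤ/n)ˣ ≃ Π_i (ℤ/ℓ_i)ˣ` and the level argument of a residue class -/

section CRT

variable {ι : Type*} [Fintype ι] [DecidableEq ι] (ℓ : ι → ℕ) [hℓ : ∀ i, Fact (ℓ i).Prime]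
  (hinj : Function.Injective ℓ)

omit [Fintype ι] [DecidableEq ι] in
include hinj in
/-- Distinct primes are pairwise coprime. [folklore] -/
theorem pairwise_coprime : Pairwise (fun i j => Nat.Coprime (ℓ i) (ℓ j)) :=
  fun i j hij => (Nat.coprime_primes (hℓ i).out (hℓ j).out).mpr fun h => hij (hinj h)

omit [DecidableEq ι] hℓ in
/-- `ℓ_i ∣ n` when `Π_i ℓ_i = n`. [folklore] -/
theorem dvd_of_prod_eq {n : ℕ} (hn : ∏ i, ℓ i = n) (i : ι) : ℓ i ∣ n :=
  hn ▸ Finset.dvd_prod_of_mem ℓ (Finset.mem_univ i)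

/-- **CRT on units**: `(ℤ/n)ˣ ≃* Π_i (ℤ/ℓ_i)ˣ` for `n = Π_i ℓ_i` (Mathlib's `ZMod.prodEquivPi` on units).
[folklore] -/
noncomputable def unitsEquivPi (n : ℕ) (hn : ∏ i, ℓ i = n) : (ZMod n)ˣ ≃* Π i, (ZMod (ℓ i))ˣ :=
  (Units.mapEquiv ((ZMod.ringEquivCongr hn.symm).trans
    (ZMod.prodEquivPi ℓ (pairwise_coprime ℓ hinj))).toMulEquiv).trans MulEquiv.piUnits

omit [DecidableEq ι] in
/-- Coordinate `i` of `unitsEquivPi a` is the reduction of `a` modulo `ℓ_i`. [folklore] -/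
theorem coe_unitsEquivPi_apply {n : ℕ} (hn : ∏ i, ℓ i = n) (a : (ZMod n)ˣ) (i : ι) :
    ((unitsEquivPi ℓ hinj n hn a i : (ZMod (ℓ i))ˣ) : ZMod (ℓ i)) =
      ZMod.castHom (dvd_of_prod_eq ℓ hn i) (ZMod (ℓ i)) (a : ZMod n) := by
  haveI : NeZero n := ⟨by rw [← hn]; exact (Finset.prod_pos fun i _ => (hℓ i).out.pos).ne'⟩
  have hcomp : ((Pi.evalRingHom (fun i => ZMod (ℓ i)) i).comp
      (((ZMod.ringEquivCongr hn.symm).trans (ZMod.prodEquivPi ℓ (pairwise_coprime ℓ hinj))).toRingHom)) =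
      ZMod.castHom (dvd_of_prod_eq ℓ hn i) (ZMod (ℓ i)) := Subsingleton.elim _ _
  have := RingHom.congr_fun hcomp (a : ZMod n)
  simpa [unitsEquivPi] using this

omit [DecidableEq ι] in
/-- … i.e. `unitsEquivPi a i = ZMod.unitsMap (ℓ_i ∣ n) a`, the map inside `kuriharaNumber`. [folklore] -/
theorem unitsEquivPi_apply {n : ℕ} (hn : ∏ i, ℓ i = n) (a : (ZMod n)ˣ) (i : ι) :
    unitsEquivPi ℓ hinj n hn a i = ZMod.unitsMap (dvd_of_prod_eq ℓ hn i) a :=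
  Units.ext (by rw [coe_unitsEquivPi_apply]; rfl)

/-- The INTEGER numerator of the level argument: `levelArg U a = crtInt U a / n_U` with
`crtInt U a = Σ_{i∈U} (a_i w_{U,i}).val · n_{U∖i}`. [folklore] -/
def crtInt (U : Finset ι) (a : Π i, (ZMod (ℓ i))ˣ) : ℤ :=
  ∑ i ∈ U, ((((a i : ZMod (ℓ i)) * crtWeight ℓ U i).val : ℕ) : ℤ) * (levelOf ℓ (U.erase i) : ℤ)

omit [Fintype ι] in
/-- `levelArg U a = crtInt U a / n_U`. [folklore] -/
theorem levelArg_eq_crtInt_div (U : Finset ι) (a : Π i, (ZMod (ℓ i))ˣ) :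
    levelArg ℓ U a = (crtInt ℓ U a : ℚ) / (levelOf ℓ U : ℚ) := by
  rw [levelArg, crtInt, Int.cast_sum, Finset.sum_div]
  refine Finset.sum_congr rfl fun i hi => ?_
  have hℓi : (ℓ i : ℚ) ≠ 0 := by exact_mod_cast (hℓ i).out.ne_zero
  have hU : (levelOf ℓ U : ℚ) ≠ 0 := by exact_mod_cast (levelOf_pos ℓ U).ne'
  have hmul : (ℓ i : ℚ) * (levelOf ℓ (U.erase i) : ℚ) = levelOf ℓ U := by
    exact_mod_cast mul_levelOf_erase ℓ hi
  push_cast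
  rw [div_eq_div_iff hℓi hU, ← hmul]
  ring

omit [Fintype ι] in
include hinj in
/-- **`crtInt U a ≡ a_j (mod ℓ_j)` for `j ∈ U`** (the terms `i ≠ j` are divisible by `ℓ_j`, the term `j`
is `(a_j w_j).val · n_{U∖j} ≡ a_j` since `w_j = n_{U∖j}⁻¹`). [folklore] -/
theorem intCast_crtInt {U : Finset ι} (a : Π i, (ZMod (ℓ i))ˣ) {j : ι} (hj : j ∈ U) :
    ((crtInt ℓ U a : ℤ) : ZMod (ℓ j)) = (a j : ZMod (ℓ j)) := by
  rw [crtInt, Int.cast_sum]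
  push_cast
  rw [← Finset.add_sum_erase U _ hj]
  have hrest : ∑ i ∈ U.erase j, ((((a i : ZMod (ℓ i)) * crtWeight ℓ U i).val : ℕ) : ZMod (ℓ j)) *
      ((levelOf ℓ (U.erase i) : ℕ) : ZMod (ℓ j)) = 0 := by
    refine Finset.sum_eq_zero fun i hi => ?_
    have hij : j ∈ U.erase i := Finset.mem_erase.2 ⟨(Finset.mem_erase.1 hi).1.symm, hj⟩
    rw [show ((levelOf ℓ (U.erase i) : ℕ) : ZMod (ℓ j)) = 0 from by
      rw [ZMod.natCast_eq_zero_iff]; exact Finset.dvd_prod_of_mem ℓ hij, mul_zero]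
  rw [hrest, add_zero, ZMod.natCast_zmod_val, crtWeight, mul_assoc,
    inv_mul_cancel₀ (natCast_levelOf_ne_zero ℓ hinj (Finset.notMem_erase j U)), mul_one]

variable (P : ℚ → ℚ) (hper : ∀ (r : ℚ) (z : ℤ), P (r + z) = P r)

include hper in
/-- **The level argument of a residue class**: for `a ∈ (ℤ/n)ˣ`, `n = Π_i ℓ_i`,
`P(levelArg univ (unitsEquivPi a)) = P(a.val/n)` — the CRT representative and the canonical one differ
by an integer (`crtInt ≡ a (mod n)` coordinate by coordinate, `intCast_crtInt`, and CRT injectivity).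
[folklore] -/
theorem apply_levelArg_unitsEquivPi {n : ℕ} (hn : ∏ i, ℓ i = n) (a : (ZMod n)ˣ) :
    P (levelArg ℓ Finset.univ (unitsEquivPi ℓ hinj n hn a)) =
      P ((((a : ZMod n).val : ℕ) : ℚ) / (n : ℚ)) := by
  haveI : NeZero n := ⟨by rw [← hn]; exact (Finset.prod_pos fun i _ => (hℓ i).out.pos).ne'⟩
  have hn0 : (n : ℚ) ≠ 0 := by exact_mod_cast NeZero.ne n
  -- `crtInt ≡ a.val (mod n)`
  have hmod : ((crtInt ℓ Finset.univ (unitsEquivPi ℓ hinj n hn a) : ℤ) : ZMod n) =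
      (((a : ZMod n).val : ℕ) : ZMod n) := by
    rw [ZMod.natCast_zmod_val]
    apply ((ZMod.ringEquivCongr hn.symm).trans (ZMod.prodEquivPi ℓ (pairwise_coprime ℓ hinj))).injective
    funext i
    have hcomp : ((Pi.evalRingHom (fun i => ZMod (ℓ i)) i).comp
        (((ZMod.ringEquivCongr hn.symm).trans (ZMod.prodEquivPi ℓ (pairwise_coprime ℓ hinj))).toRingHom)) =
        ZMod.castHom (dvd_of_prod_eq ℓ hn i) (ZMod (ℓ i)) := Subsingleton.elim _ _
    have h1 := RingHom.congr_fun hcomp ((crtInt ℓ Finset.univ (unitsEquivPi ℓ hinj n hn a) : ℤ) : ZMod n)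
    have h2 := RingHom.congr_fun hcomp (a : ZMod n)
    simp only [RingHom.coe_comp, Function.comp_apply, Pi.evalRingHom_apply, RingEquiv.toRingHom_eq_coe,
      RingHom.coe_coe] at h1 h2
    rw [h1, h2, map_intCast, intCast_crtInt ℓ hinj _ (Finset.mem_univ i), coe_unitsEquivPi_apply]
  rw [← Int.cast_natCast, ZMod.intCast_eq_intCast_iff_dvd_sub] at hmod
  obtain ⟨t, ht⟩ := hmod
  have hlev : (levelOf ℓ (Finset.univ : Finset ι) : ℚ) = n := by
    rw [← hn]; rfl
  apply apply_eq_of_sub_eq_intCast P hper (z := -t)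
  rw [levelArg_eq_crtInt_div, hlev,
    show (crtInt ℓ Finset.univ (unitsEquivPi ℓ hinj n hn a) : ℚ) =
      ((((a : ZMod n).val : ℕ) : ℤ) : ℚ) - (n : ℚ) * (t : ℚ) by exact_mod_cast (by linarith : (crtInt ℓ
        Finset.univ (unitsEquivPi ℓ hinj n hn a) : ℤ) = (((a : ZMod n).val : ℕ) : ℤ) - (n : ℤ) * t)]
  push_cast
  field_simp
  ring

end CRT

/-! ### The identity on `(ℤ/n)ˣ` -/

section Transport

variable {ι : Type*} [Fintype ι] [DecidableEq ι] (ℓ : ι → ℕ) [hℓ : ∀ i, Fact (ℓ i).Prime]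
  (hinj : Function.Injective ℓ) (P : ℚ → ℚ) (hper : ∀ (r : ℚ) (z : ℤ), P (r + z) = P r)
  {p : ℕ} [hp : Fact p.Prime] (k : ℕ) (A : ι → ℤ)
  (hhecke : ∀ (i : ι) (r : ℚ), (A i : ℚ) * P r =
    ∑ j : Fin (ℓ i), P ((r + ((j : ℕ) : ℚ)) / (ℓ i : ℚ)) + P ((ℓ i : ℚ) * r))
  (hA : ∀ i, ((A i : ℤ) : ZMod (p ^ k)) = 2)
  (hint : ∀ (U : Finset ι) (a : Π i, (ZMod (ℓ i))ˣ), ‖((P (levelArg ℓ U a) : ℚ) : ℚ_[p])‖ ≤ 1)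

include hinj hper hhecke hA hint in
/-- **THE BINS-TO-`δ̃` IDENTITY ON `(ℤ/n)ˣ`** (`n = Π_i ℓ_i`, the coordinates of the tree's
`kuriharaNumber`): for `P` `1`-periodic with the Hecke relation (eigenvalues `A_i ≡ 2 (mod p^k)`) at the
distinct primes `ℓ_i` and `p`-integral at the level arguments, discrete logarithms
`ψ_i : (ℤ/ℓ_i)ˣ → ℤ/p^k`, bin index `m(a) = (Σ_i ψ_i(a mod ℓ_i)).val`, and `ν = #ι < p`, `t ≤ ν`:
`Σ_{a ∈ (ℤ/n)ˣ} \overline{P(a/n)}·binom(m(a), t) = [t = ν]·Σ_{a ∈ (ℤ/n)ˣ} \overline{P(a/n)}·Π_i ψ_i(a mod ℓ_i)`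
— the binomial moments of the character bins vanish below `ν` and the `ν`-th is the Kurihara sum.
[cite: Kim2022StructureSelmer, §1.4.3 (PDF p. 7)] -/
theorem sum_units_ratModP_mul_choose_eq {n : ℕ} [NeZero n] (hn : ∏ i, ℓ i = n)
    (ψ : Π i, (ZMod (ℓ i))ˣ →* Multiplicative (ZMod (p ^ k))) (hcard : Fintype.card ι < p)
    (t : ℕ) (ht : t ≤ Fintype.card ι) :
    ∑ a : (ZMod n)ˣ, ratModP (p ^ k) (P ((((a : ZMod n).val : ℕ) : ℚ) / (n : ℚ))) *
        ((((∑ i, Multiplicative.toAdd (ψ i (ZMod.unitsMap (dvd_of_prod_eq ℓ hn i) a))).val.choose t : ℕ) :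
          ZMod (p ^ k))) =
      if t = Fintype.card ι then
        ∑ a : (ZMod n)ˣ, ratModP (p ^ k) (P ((((a : ZMod n).val : ℕ) : ℚ) / (n : ℚ))) *
          ∏ i, Multiplicative.toAdd (ψ i (ZMod.unitsMap (dvd_of_prod_eq ℓ hn i) a))
      else 0 := by
  have h := sum_ratModP_levelArg_mul_choose_eq ℓ hinj P hper k A hhecke hA hint ψ hcard t ht
  have hL : ∑ a : (ZMod n)ˣ, ratModP (p ^ k) (P ((((a : ZMod n).val : ℕ) : ℚ) / (n : ℚ))) *
        ((((∑ i, Multiplicative.toAdd (ψ i (ZMod.unitsMap (dvd_of_prod_eq ℓ hn i) a))).val.choose t : ℕ) :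
          ZMod (p ^ k))) =
      ∑ b : Π i, (ZMod (ℓ i))ˣ, ratModP (p ^ k) (P (levelArg ℓ Finset.univ b)) *
        ((((∑ i, Multiplicative.toAdd (ψ i (b i))).val.choose t : ℕ) : ZMod (p ^ k))) :=
    Fintype.sum_equiv (unitsEquivPi ℓ hinj n hn).toEquiv _ _ fun a => by
      simp only [MulEquiv.toEquiv_eq_coe, MulEquiv.coe_toEquiv, unitsEquivPi_apply,
        apply_levelArg_unitsEquivPi ℓ hinj P hper hn]
  have hR : ∑ a : (ZMod n)ˣ, ratModP (p ^ k) (P ((((a : ZMod n).val : ℕ) : ℚ) / (n : ℚ))) *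
        ∏ i, Multiplicative.toAdd (ψ i (ZMod.unitsMap (dvd_of_prod_eq ℓ hn i) a)) =
      ∑ b : Π i, (ZMod (ℓ i))ˣ, ratModP (p ^ k) (P (levelArg ℓ Finset.univ b)) *
        ∏ i, Multiplicative.toAdd (ψ i (b i)) :=
    Fintype.sum_equiv (unitsEquivPi ℓ hinj n hn).toEquiv _ _ fun a => by
      simp only [MulEquiv.toEquiv_eq_coe, MulEquiv.coe_toEquiv, unitsEquivPi_apply,
        apply_levelArg_unitsEquivPi ℓ hinj P hper hn]
  rw [hL, hR]
  exact h

end Transport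

end Summit.BirchSwinnertonDyer.Rank1Residual.Supersingular.KuriharaTwist.Identity
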